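import Literature.MeasureTheory.Lusin.LusinTheorem
import Mathlib.MeasureTheory.Measure.Lebesgue.Basic
import Mathlib.MeasureTheory.Measure.Haar.OfBasis
import Mathlib.Topology.TietzeExtension
import HarnessLib

/-!
# Lusin's theorem on the real line, with a continuous extension (Royden's form)

Topic `Literature/MeasureTheory/Lusin`.  Fully proved.  For Lebesgue measure `m` on `ℝ`, a measurable
`h : ℝ → ℝ`, a measurable set `E ⊆ ℝ` of ARBITRARY (possibly infinite) measure and `ε ≠ 0`:

* `Real.exists_continuous_isClosed_subset_eqOn` — **Lusin's Theorem** (Royden–Fitzpatrick, *Real Analysis*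
  4th ed., §3.3 p. 66, with the infinite-measure case of Problem 29 p. 67): there is a function `g`
  continuous on all of `ℝ` and a CLOSED set `F ⊆ E` with `m(E ∖ F) < ε` and `h = g` on `F`.

Proof: on each unit cell `[n, n+1)`, `n ∈ ℤ`, apply the tree's finite-measure Lusin theorem
(`exists_isCompact_subset_diff_lt_continuousOn`, Kechris 17.12) to the finite measure `m|[n,n+1)` with
defect `δₙ`, `Σ δₙ < ε`, obtaining compact `Kₙ ⊆ E` with `h` continuous on `Kₙ`; the cells
`Kₙ ∩ [n, n+1]` form a locally finite family of closed sets, so their union `F` is closed and `h` is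
continuous on `F` (`LocallyFinite.continuousOn_iUnion`); `m(E ∖ F) ≤ Σ δₙ < ε`; finally extend `h|_F`
continuously to `ℝ` by the Tietze extension theorem (Royden's Problem 25).

## References

* H. L. Royden, P. M. Fitzpatrick, *Real Analysis*, 4th ed., Pearson (2010), §3.3 «Lusin's Theorem»
  p. 66; Problems 25, 29 p. 67. [RoydenFitzpatrick2010]
* A. S. Kechris, *Classical Descriptive Set Theory*, GTM 156, Springer (1995), Thm 17.12. [Kechris1995]
-/

noncomputable section

open Set Filter TopologicalSpace
open _root_.MeasureTheory
open scoped ENNReal Topology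

namespace Literature.MeasureTheory.Lusin

/-- The unit cells `K n ∩ [n, n+1]`, `n ∈ ℤ`, of any family form a locally finite family in `ℝ`. [folklore] -/
private theorem locallyFinite_inter_Icc (K : ℤ → Set ℝ) :
    LocallyFinite fun n : ℤ => K n ∩ Icc (n : ℝ) (n + 1) := by
  intro x
  refine ⟨Ioo (x - 1) (x + 1), Ioo_mem_nhds (by linarith) (by linarith), ?_⟩
  refine (Set.finite_Icc (⌊x⌋ - 1) (⌊x⌋ + 1)).subset fun n hn => ?_
  obtain ⟨y, ⟨-, hy1, hy2⟩, hy3, hy4⟩ := hn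
  have hx1 := Int.floor_le x
  have hx2 := Int.lt_floor_add_one x
  constructor
  · by_contra hlt
    push Not at hlt
    have : (n : ℝ) + 1 ≤ (⌊x⌋ : ℝ) - 1 := by exact_mod_cast (by omega : n + 1 ≤ ⌊x⌋ - 1)
    linarith
  · by_contra hlt
    push Not at hlt
    have : (⌊x⌋ : ℝ) + 2 ≤ (n : ℝ) := by exact_mod_cast (by omega : ⌊x⌋ + 2 ≤ n)
    linarith

/-- **Lusin's Theorem on the real line (Royden's form, with a continuous extension).** Let `h : ℝ → ℝ`
be measurable and `E ⊆ ℝ` measurable (of finite or infinite Lebesgue measure). For every `ε ≠ 0` there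
are a continuous `g : ℝ → ℝ` and a closed set `F ⊆ E` with `volume (E \ F) < ε` and `h = g` on `F`.
[cite: RoydenFitzpatrick2010, §3.3 Lusin's Theorem p. 66; Problems 25 and 29 p. 67] -/
theorem Real.exists_continuous_isClosed_subset_eqOn {h : ℝ → ℝ} (hh : Measurable h) {E : Set ℝ}
    (hE : MeasurableSet E) {ε : ℝ≥0∞} (hε : ε ≠ 0) :
    ∃ (g : ℝ → ℝ) (F : Set ℝ), Continuous g ∧ IsClosed F ∧ F ⊆ E ∧ volume (E \ F) < ε ∧
      ∀ x ∈ F, h x = g x := by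
  -- defects `δ n > 0`, `Σ δ n < ε`
  obtain ⟨δ, hδpos, hδsum⟩ := ENNReal.exists_pos_sum_of_countable' hε ℤ
  -- finite-measure Lusin on each cell `[n, n+1)`
  have hcell : ∀ n : ℤ, ∃ K : Set ℝ, K ⊆ E ∧ IsCompact K ∧
      volume.restrict (Ico (n : ℝ) (n + 1)) (E \ K) < δ n ∧ ContinuousOn h K := by
    intro n
    haveI : Fact (volume (Ico (n : ℝ) (n + 1)) < ∞) := ⟨measure_Ico_lt_top⟩
    exact exists_isCompact_subset_diff_lt_continuousOn (μ := volume.restrict (Ico (n : ℝ) (n + 1)))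
      hh hE (hδpos n).ne'
  choose K hKE hKc hKμ hKcont using hcell
  -- the closed set: the locally finite union of the compact cells `K n ∩ [n, n+1]`
  set C : ℤ → Set ℝ := fun n => K n ∩ Icc (n : ℝ) (n + 1) with hC
  have hCclosed : ∀ n, IsClosed (C n) := fun n => ((hKc n).inter_right isClosed_Icc).isClosed
  have hLF : LocallyFinite C := locallyFinite_inter_Icc K
  set F : Set ℝ := ⋃ n, C n with hF
  have hFclosed : IsClosed F := hLF.isClosed_iUnion hCclosed
  have hFE : F ⊆ E := iUnion_subset fun n => inter_subset_left.trans (hKE n)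
  have hFcont : ContinuousOn h F :=
    hLF.continuousOn_iUnion (fun n => hCclosed n) fun n => (hKcont n).mono inter_subset_left
  -- the measure of `E \ F`
  have hdiff : E \ F ⊆ ⋃ n : ℤ, (E \ K n) ∩ Ico (n : ℝ) (n + 1) := by
    intro x hx
    refine mem_iUnion.2 ⟨⌊x⌋, ⟨hx.1, fun hxK => hx.2 ?_⟩, Int.floor_le x, Int.lt_floor_add_one x⟩
    exact mem_iUnion.2 ⟨⌊x⌋, hxK, Int.floor_le x, (Int.lt_floor_add_one x).le⟩
  have hμ : volume (E \ F) < ε := by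
    calc volume (E \ F) ≤ volume (⋃ n : ℤ, (E \ K n) ∩ Ico (n : ℝ) (n + 1)) := measure_mono hdiff
      _ ≤ ∑' n : ℤ, volume ((E \ K n) ∩ Ico (n : ℝ) (n + 1)) := measure_iUnion_le _
      _ ≤ ∑' n : ℤ, δ n := ENNReal.tsum_le_tsum fun n => by
          rw [← Measure.restrict_apply' measurableSet_Ico]
          exact (hKμ n).le
      _ < ε := hδsum
  -- Tietze extension of `h|_F`
  obtain ⟨g, hg⟩ := ContinuousMap.exists_restrict_eq hFclosed ⟨F.restrict h, hFcont.restrict⟩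
  refine ⟨g, F, g.continuous, hFclosed, hFE, hμ, fun x hx => ?_⟩
  have := congrArg (fun φ : C(F, ℝ) => φ ⟨x, hx⟩) hg
  simpa using this.symm

end Literature.MeasureTheory.Lusin

end
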